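import Mathlib
import Literature.Analysis.FluidPDE.Tao2016AveragedNS.BoundedEternalSolutions
import Summits.NavierStokesRegularity.NavierStokesRegularity.Theorems.WakeRatchetTailRatchetDyadicTypeIRate
import Summits.NavierStokesRegularity.NavierStokesRegularity.Theorems.WakeRatchetTailRatchet.Negative.TailRatchetFalseOfDyadicScalarFronts
import HarnessLib

/-!
# `WakeRatchet.TailRatchet` (stmt-NavierStokesRegularity-21808) — a UNIVERSAL CEILING for the hypothesis
# class on the dyadic member: every uniformly bounded inviscid eternal solution of `dyadicTable` with
# non-negative carrier obeys `W_n(σ)₀ ≤ 2Λ²/(Λ−1)²`, `Λ = bigLam ε₀`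

Support lemma for the aside crux `TailRatchet` (route `WakeRatchet`; MODEL lattice ODEs of Tao 2016 §4 in
the renormalised variables of §6.4 — nothing here concerns the Navier–Stokes equations; stmt-21808 is
neither proved nor refuted; no stub of skeleton d00b85951d7c is closed).

The crux quantifies over admissible eternal solutions `W` with `UniformBound W` (SOME constant).  For the
scalar dyadic member `dyadicTable ∈ E₂(2)` (the table every recorded witness / construction door of the
item lives on) the type-I rate of the companion file (`WakeRatchetDyadicTypeI.typeI_dyadic`) makes that
constant UNIVERSAL: reading `W` in physical variables `Xₙ(t) = Λ⁻ⁿ e^{σ} W_n(σ)₀`, `t = −e^{−σ} < 0`,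
gives a non-negative solution of `Ẋₙ = Λⁿ⁻¹Xₙ₋₁² − ΛⁿXₙXₙ₊₁` on `(−∞, 0)` which is regular on every
`(a, T′)`, `T′ < 0` (there `Λⁿ|Xₙ(t)| = |W_n(σ)₀|/|t| ≤ C/|T′|`), so `(0 − t)·ΛⁿXₙ(t) = W_n(σ)₀ ≤ 2Λ²/(Λ−1)²`:

* `hasDerivAt_coord_zero` — the carrier coordinate `u_n = (W_n)₀` of an inviscid eternal solution of
  `dyadicTable` solves the scalar renormalised law `u_n' = −u_n + Λu_{n−1}² − Λ⁻¹u_nu_{n+1}`;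
* `hasDerivAt_phys` — its physical-time transcription solves the dyadic chain on `t < 0`;
* `eternal_ceiling_dyadic` — **the ceiling**: `IsEternal ε₀ dyadicTable W`, `UniformBound W`, `(W_n)₀ ≥ 0`
  ⟹ `W_n(σ)₀ ≤ 2·bigLam ε₀²/(bigLam ε₀ − 1)²` for all `n, σ` (≈ `0.32/ε₀²` as `ε₀ → 0`).  Compare the
  tree's FLOOR `sup‖W‖ > 1/(896ε₀)` for non-trivial admissible solutions
  (`WakeRatchetTailRatchetEternalFloor`): on the dyadic member the witnesses the crux asks about live in
  the explicit amplitude window `[1/(896ε₀), 2Λ²/(Λ−1)²]`, uniformly — no large-amplitude escape.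

HONEST FRAMING: a change of variables on top of the type-I rate; MODEL lattice only; rung 0.
-/

noncomputable section

set_option linter.dupNamespace false

namespace Summit.NavierStokesRegularity.NavierStokesRegularity.Theorems

namespace WakeRatchetDyadicTypeI

open Set Filter Topology
open Literature.Analysis.FluidPDE Literature.Analysis.FluidPDE.TaoCascade
open WakeRatchetDyadicFront

/-- The carrier coordinate of an inviscid eternal solution of the dyadic member solves the scalar
renormalised law `u_n' = −u_n + Λ u_{n−1}² − Λ⁻¹ u_n u_{n+1}`.
[cite: Tao2016AveragedNS, §1.2 (dyadic model), §4 Lemma 4.1 (4.8) in the variables of §6.4; cell vocabulary (`IsEternal`, `dyadicTable`)] -/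
theorem hasDerivAt_coord_zero {ε₀ : ℝ} {W : ℤ → ℝ → Em 4} (hW : IsEternal ε₀ dyadicTable W)
    (n : ℤ) (σ : ℝ) :
    HasDerivAt (fun s => W n s 0)
      (-(W n σ 0) + bigLam ε₀ * (W (n - 1) σ 0) ^ 2
        - (bigLam ε₀)⁻¹ * (W n σ 0) * (W (n + 1) σ 0)) σ := by
  have h := ((EuclideanSpace.proj (0 : Fin 4) : Em 4 →L[ℝ] ℝ).hasFDerivAt).comp_hasDerivAt σ
    (hW.law n σ)
  have hcoe : ((EuclideanSpace.proj (0 : Fin 4) : Em 4 →L[ℝ] ℝ) : Em 4 → ℝ) ∘ W n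
      = fun s => W n s 0 := by
    funext s; rfl
  rw [hcoe] at h
  refine h.congr_deriv ?_
  simp only [tableQ_dyadicTable, tableA_dyadicTable, tableB_dyadicTable]
  simp
  ring

/-- Physical-time transcription: `X_n(t) = (Λⁿ)⁻¹ e^{σ} u_n(σ)`, `σ = −log(−t)`, solves the dyadic chain
`Ẋₙ = Λⁿ⁻¹Xₙ₋₁² − ΛⁿXₙXₙ₊₁` on `t < 0`.
[cite: Tao2016AveragedNS, §1.2, §4 Lemma 4.1 (4.8), §6.4 (`s = −log(t_* − t)`); elementary (chain rule)] -/
theorem hasDerivAt_phys {Λ : ℝ} (hΛ : 0 < Λ) {u : ℤ → ℝ → ℝ}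
    (hu : ∀ n s, HasDerivAt (u n) (-(u n s) + Λ * (u (n - 1) s) ^ 2 - Λ⁻¹ * (u n s) * (u (n + 1) s)) s)
    (n : ℤ) {t : ℝ} (ht : t < 0) :
    HasDerivAt (fun r => (Λ ^ n)⁻¹ * (Real.exp (-Real.log (-r)) * u n (-Real.log (-r))))
      (Λ ^ (n - 1) * ((Λ ^ (n - 1))⁻¹ * (Real.exp (-Real.log (-t)) * u (n - 1) (-Real.log (-t)))) ^ 2
        - Λ ^ n * ((Λ ^ n)⁻¹ * (Real.exp (-Real.log (-t)) * u n (-Real.log (-t))))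
          * ((Λ ^ (n + 1))⁻¹ * (Real.exp (-Real.log (-t)) * u (n + 1) (-Real.log (-t))))) t := by
  have hΛne : Λ ≠ 0 := hΛ.ne'
  have ht' : 0 < -t := neg_pos.2 ht
  -- the clock `σ(r) = −log(−r)` has derivative `(−t)⁻¹ = e^{σ(t)}`
  have hσ : HasDerivAt (fun r : ℝ => -Real.log (-r)) ((-t)⁻¹) t := by
    have h1 : HasDerivAt (fun r : ℝ => Real.log (-r)) ((-t)⁻¹ * (-1)) t :=
      (Real.hasDerivAt_log ht'.ne').comp t (hasDerivAt_neg t)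
    have h2 : HasDerivAt (fun r : ℝ => -Real.log (-r)) (-((-t)⁻¹ * (-1))) t := h1.neg
    exact h2.congr_deriv (by ring)
  have hexpσ : Real.exp (-Real.log (-t)) = (-t)⁻¹ := by
    rw [Real.exp_neg, Real.exp_log ht']
  -- `g(s) = e^{s} u_n(s)`
  set s₀ : ℝ := -Real.log (-t) with hs₀
  have hg : HasDerivAt (fun s => Real.exp s * u n s)
      (Real.exp s₀ * u n s₀ + Real.exp s₀ *
        (-(u n s₀) + Λ * (u (n - 1) s₀) ^ 2 - Λ⁻¹ * (u n s₀) * (u (n + 1) s₀))) s₀ :=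
    (Real.hasDerivAt_exp s₀).mul (hu n s₀)
  have hcomp := (hg.comp t hσ).const_mul ((Λ ^ n)⁻¹)
  refine hcomp.congr_deriv ?_
  -- algebra: `(−t)⁻¹ = e^{s₀}` and the zpow bookkeeping
  rw [← hexpσ]
  have h1 : (Λ ^ (n - 1) : ℝ) = Λ ^ n * Λ⁻¹ := zpow_sub_one₀ hΛne n
  have h2 : (Λ ^ (n + 1) : ℝ) = Λ ^ n * Λ := zpow_add_one₀ hΛne n
  have hzn : (Λ ^ n : ℝ) ≠ 0 := zpow_ne_zero n hΛne
  rw [h1, h2]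
  field_simp
  ring

/-- **Universal ceiling on the dyadic member.**  Every uniformly bounded inviscid admissible eternal
solution `W` of `dyadicTable` whose carrier coordinate is non-negative satisfies
`W_n(σ)₀ ≤ 2·Λ²/(Λ−1)²`, `Λ = bigLam ε₀`, at every shell and log-time — the constant of `UniformBound W`
is universal on this class (via the type-I rate `typeI_dyadic` in physical variables).
[cite: Tao2016AveragedNS, §1.2, §4 Lemma 4.1 (4.8), §6.4; cell vocabulary (`IsEternal`, `UniformBound`, `dyadicTable`)] -/
theorem eternal_ceiling_dyadic {ε₀ : ℝ} (hε : 0 < ε₀) {W : ℤ → ℝ → Em 4}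
    (hW : IsEternal ε₀ dyadicTable W) (hU : UniformBound W) (hpos : ∀ n σ, 0 ≤ W n σ 0)
    (n : ℤ) (σ : ℝ) :
    W n σ 0 ≤ 2 * bigLam ε₀ ^ 2 / (bigLam ε₀ - 1) ^ 2 := by
  set Λ : ℝ := bigLam ε₀ with hΛdef
  have hΛ1 : 1 < Λ := by
    rw [hΛdef]; unfold bigLam
    exact Real.one_lt_rpow (by linarith) (by norm_num)
  have hΛ0 : 0 < Λ := by linarith
  obtain ⟨C, hC⟩ := hU
  -- the carrier in renormalised and in physical variables
  set u : ℤ → ℝ → ℝ := fun m s => W m s 0 with hudef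
  have hu : ∀ m s, HasDerivAt (u m) (-(u m s) + Λ * (u (m - 1) s) ^ 2 - Λ⁻¹ * (u m s) * (u (m + 1) s)) s :=
    fun m s => hasDerivAt_coord_zero hW m s
  set X : ℤ → ℝ → ℝ := fun m r => (Λ ^ m)⁻¹ * (Real.exp (-Real.log (-r)) * u m (-Real.log (-r)))
    with hXdef
  -- the physical instant of `σ`
  set t₀ : ℝ := -Real.exp (-σ) with ht₀def
  have ht₀ : t₀ < 0 := by rw [ht₀def]; exact neg_neg_iff_pos.2 (Real.exp_pos _)
  have hlogt₀ : -Real.log (-t₀) = σ := by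
    rw [ht₀def, neg_neg, Real.log_exp, neg_neg]
  -- the law on `(t₀ − 1, 0)`
  have hlaw : ∀ m : ℤ, n ≤ m → ∀ t ∈ Ioo (t₀ - 1) 0,
      HasDerivAt (X m) (Λ ^ (m - 1) * X (m - 1) t ^ 2 - Λ ^ m * X m t * X (m + 1) t) t := by
    intro m _ t ht
    have h := hasDerivAt_phys hΛ0 hu m ht.2
    simpa only [hXdef] using h
  -- regularity on every `(t₀ − 1, T')`, `T' < 0`: `Λᵐ|X_m(t)| = |u_m(σ)|/|t| ≤ C/|T'|`
  have hreg : ∀ T', T' < 0 → ∃ B : ℝ, ∀ m : ℤ, n - 1 ≤ m → ∀ t ∈ Ioo (t₀ - 1) T',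
      |Λ ^ m * X m t| ≤ B := by
    intro T' hT'
    refine ⟨C * (-T')⁻¹, fun m _ t ht => ?_⟩
    have htneg : 0 < -t := by linarith [ht.2]
    have hzm : (Λ ^ m : ℝ) ≠ 0 := zpow_ne_zero m hΛ0.ne'
    have hid : Λ ^ m * X m t = (-t)⁻¹ * u m (-Real.log (-t)) := by
      simp only [hXdef]
      rw [Real.exp_neg, Real.exp_log htneg]
      field_simp
    rw [hid, abs_mul, abs_of_pos (inv_pos.2 htneg)]
    have hu_le : |u m (-Real.log (-t))| ≤ C := by
      have h1 := PiLp.norm_apply_le (W m (-Real.log (-t))) (0 : Fin 4)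
      rw [Real.norm_eq_abs] at h1
      exact h1.trans (hC m _)
    have hC0 : 0 ≤ C := (abs_nonneg _).trans hu_le
    have hinv : (-t)⁻¹ ≤ (-T')⁻¹ := inv_anti₀ (by linarith) (by linarith [ht.2])
    calc (-t)⁻¹ * |u m (-Real.log (-t))| ≤ (-T')⁻¹ * C :=
          mul_le_mul hinv hu_le (abs_nonneg _) (inv_nonneg.2 (by linarith))
      _ = C * (-T')⁻¹ := mul_comm _ _
  -- non-negativity of the shells above `n` at `t₀`
  have hposX : ∀ m : ℤ, n < m → 0 ≤ X m t₀ := by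
    intro m _
    simp only [hXdef]
    exact mul_nonneg (inv_nonneg.2 (zpow_pos hΛ0 m).le)
      (mul_nonneg (Real.exp_pos _).le (hpos m _))
  -- the type-I rate at `t₀`
  have h := typeI_dyadic (N := n) hΛ1 hlaw hreg ⟨by linarith, ht₀⟩ hposX
  -- `(0 − t₀)·Λⁿ X_n(t₀) = u_n(σ)`
  have hid : (0 - t₀) * (Λ ^ n * X n t₀) = u n σ := by
    simp only [hXdef]
    rw [hlogt₀, ht₀def]
    have hzn : (Λ ^ n : ℝ) ≠ 0 := zpow_ne_zero n hΛ0.ne'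
    have hexp : Real.exp (-σ) * Real.exp σ = 1 := by rw [← Real.exp_add]; simp
    field_simp
    linear_combination (u n σ) * hexp
  rw [hid] at h
  simpa only [hudef] using h

end WakeRatchetDyadicTypeI

end Summit.NavierStokesRegularity.NavierStokesRegularity.Theorems

end
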